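import Summits.RiemannHypothesis.RiemannHypothesis.Theorems.UniversalFactorMediumBoxDefs
import Summits.RiemannHypothesis.RiemannHypothesis.Theorems.UniversalFactorMediumKernelNoGoStubPhiPartialC
import Summits.RiemannHypothesis.RiemannHypothesis.Theorems.UniversalFactorMediumKernelNoGoStubPhiTailN
import Summits.RiemannHypothesis.RiemannHypothesis.Theorems.UniversalFactorMediumKernelNoGoStubQuadH
import Summits.RiemannHypothesis.RiemannHypothesis.Theorems.UniversalFactorMediumKernelNoGoStubPhiIoiTail
import Summits.RiemannHypothesis.RiemannHypothesis.Theorems.UniversalFactorLaplaceLoopholeConvolution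
import Literature.NumberTheory.LFunctions.XiIntegralWintnerProofs

/-!
# RiemannHypothesis / UniversalFactor — the u-cells of the certified `H_0` evaluator (soundness, I)

Route `RiemannHypothesis/UniversalFactor`, crux `MediumKernelNoGo` (stmt-RiemannHypothesis-2577), line
`one-sided-average-sign-test`.  The analytic half of the soundness of the u-side evaluator `osaH0`
(`UniversalFactorMediumDefs.lean`): `H_0(x') = ∫₀^∞ Φ(u) cos(x'u) du` is cut into the u-cells
`[2cρ, 2(c+1)ρ]` and the tail `[U, ∞)`; on each cell `Φ = Φ_N + (Φ − Φ_N)` with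
`0 ≤ Φ − Φ_N ≤ T_N` (`stub_phiTailN`, and `T_N` is decreasing), and the Gauss–Legendre error of
`Φ_N(u) cos(x'u)` is controlled by `stub_quadH` with the disc majorant of the entire theta partial sum
(`stub_phiPartialC`) times `e^{x'R}`; the tail is `stub_phiIoiTail`.  Main results:
`osaCell_error` (registered sub-goal `stub_osaCellError`), `osaH0_decomp`, `osaUTail_error`.
-/

set_option linter.dupNamespace false

noncomputable section

namespace Summit.RiemannHypothesis.RiemannHypothesis.Theorems

open MeasureTheory Set
open Literature.NumberTheory.LFunctions
open Literature.Analysis.ValidatedNumerics Literature.Analysis.ValidatedNumerics.NumericsMP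

/-! ## Table facts -/

/-- Every node of the rule lies in `[−1, 1]` (as scaled integers). [folklore] -/
theorem UniversalFactor.osaNodes_abs_le :
    ∀ j ∈ Finset.range 32, |UniversalFactor.osaNodes.getD j 0| ≤ (10 : ℤ) ^ 100 := by
  decide

/-- `|t_j| ≤ 1`. [folklore] -/
theorem UniversalFactor.abs_osaNodeR_le {j : ℕ} (hj : j < 32) : |UniversalFactor.osaNodeR j| ≤ 1 := by
  have h := UniversalFactor.osaNodes_abs_le j (Finset.mem_range.2 hj)
  unfold UniversalFactor.osaNodeR UniversalFactor.osaGlS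
  have hpos : (0:ℝ) < ((10 ^ 100 : ℕ) : ℝ) := by positivity
  rw [abs_div, abs_of_pos hpos, div_le_one hpos]
  have h' : ((|UniversalFactor.osaNodes.getD j 0| : ℤ) : ℝ) ≤ (10 : ℝ) ^ 100 := by exact_mod_cast h
  rw [Int.cast_abs] at h'
  simpa only [Nat.cast_pow, Nat.cast_ofNat] using h'

/-! ## The theta tail bound is decreasing -/

/-- `T_N` is antitone on `[0, ∞)` (for `N ≥ 1`). [folklore] -/
theorem UniversalFactor.osaThetaT_antitone {N : ℕ} (hN : 1 ≤ N) {u v : ℝ} (hu : 0 ≤ u) (huv : u ≤ v) :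
    UniversalFactor.osaThetaT N v ≤ UniversalFactor.osaThetaT N u := by
  unfold UniversalFactor.osaThetaT
  have hN' : (1:ℝ) ≤ N := by exact_mod_cast hN
  set m : ℝ := (N : ℝ) + 1 with hm
  have hm2 : 4 ≤ m ^ 2 := by nlinarith
  have hπ : 3 < Real.pi := Real.pi_gt_three
  have h1 : Real.exp (4 * u) * (1 + 4 * (v - u)) ≤ Real.exp (4 * v) := by
    have ha := Real.add_one_le_exp (4 * (v - u))
    calc Real.exp (4 * u) * (1 + 4 * (v - u)) ≤ Real.exp (4 * u) * Real.exp (4 * (v - u)) := by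
          gcongr; linarith
      _ = Real.exp (4 * v) := by rw [← Real.exp_add]; ring_nf
  have h2 : 1 ≤ Real.exp (4 * u) := Real.one_le_exp (by linarith)
  have h3 : 4 * (v - u) ≤ Real.exp (4 * v) - Real.exp (4 * u) := by nlinarith
  have h4 : 9 * (v - u) ≤ Real.pi * m ^ 2 * (Real.exp (4 * v) - Real.exp (4 * u)) := by
    have h5 : Real.pi * m ^ 2 * (4 * (v - u)) ≤ Real.pi * m ^ 2 * (Real.exp (4 * v) - Real.exp (4 * u)) :=
      mul_le_mul_of_nonneg_left h3 (by positivity)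
    have hvu : 0 ≤ v - u := by linarith
    have h6 : 9 ≤ Real.pi * m ^ 2 * 4 := by nlinarith
    calc 9 * (v - u) ≤ Real.pi * m ^ 2 * 4 * (v - u) := mul_le_mul_of_nonneg_right h6 hvu
      _ = Real.pi * m ^ 2 * (4 * (v - u)) := by ring
      _ ≤ _ := h5
  have key : 9 * v + -(Real.pi * m ^ 2 * Real.exp (4 * v)) ≤ 9 * u + -(Real.pi * m ^ 2 * Real.exp (4 * u)) := by
    nlinarith
  have hexp := Real.exp_le_exp.2 key
  rw [Real.exp_add, Real.exp_add] at hexp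
  have h0 : (0:ℝ) ≤ 4 * Real.pi ^ 2 * m ^ 4 := by positivity
  calc 4 * Real.pi ^ 2 * m ^ 4 * Real.exp (9 * v) * Real.exp (-(Real.pi * m ^ 2 * Real.exp (4 * v)))
      = 4 * Real.pi ^ 2 * m ^ 4 * (Real.exp (9 * v) * Real.exp (-(Real.pi * m ^ 2 * Real.exp (4 * v)))) := by ring
    _ ≤ 4 * Real.pi ^ 2 * m ^ 4 * (Real.exp (9 * u) * Real.exp (-(Real.pi * m ^ 2 * Real.exp (4 * u)))) :=
        mul_le_mul_of_nonneg_left hexp h0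
    _ = _ := by ring

/-! ## The disc majorant of the theta partial sum -/

/-- On the circle `‖z − uc‖ = R` (`uc` real, `0 < R ≤ 1/4`): `‖S_N(z)‖ ≤ PhiMaj(uc, R)`. [folklore] -/
theorem UniversalFactor.norm_osaPhiNC_le {N : ℕ} {uc R : ℝ} (hR0 : 0 < R) (hR : R ≤ 1 / 4) {z : ℂ}
    (hz : z ∈ Metric.sphere ((uc : ℝ) : ℂ) R) :
    ‖UniversalFactor.osaPhiNC N z‖ ≤ UniversalFactor.osaPhiMajR N uc R := by
  obtain ⟨-, -, hbound⟩ := UniversalFactor.stub_phiPartialC N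
  have hb := hbound z
  unfold UniversalFactor.osaPhiNC
  refine hb.trans ?_
  unfold UniversalFactor.osaPhiMajR
  rw [Metric.mem_sphere, dist_eq_norm] at hz
  have hre : |z.re - uc| ≤ R := by
    have := Complex.abs_re_le_norm (z - uc); simp at this; rw [← hz]; exact this
  have him : |z.im| ≤ R := by
    have := Complex.abs_im_le_norm (z - uc); simp at this; rw [← hz]; exact this
  have hre' := abs_le.1 hre
  have hc4 : 1 - 8 * R ^ 2 ≤ Real.cos (4 * z.im) := by
    have h := Real.one_sub_sq_div_two_le_cos (x := 4 * z.im)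
    have : (4 * z.im) ^ 2 / 2 ≤ 8 * R ^ 2 := by
      have := abs_le.1 him; nlinarith
    linarith
  have hc4pos : 0 ≤ 1 - 8 * R ^ 2 := by nlinarith
  refine Finset.sum_le_sum fun n _ => ?_
  have hA : 2 * Real.pi ^ 2 * ((n:ℝ) + 1) ^ 4 * Real.exp (9 * z.re) + 3 * Real.pi * ((n:ℝ) + 1) ^ 2 * Real.exp (5 * z.re) ≤
      2 * Real.pi ^ 2 * ((n:ℝ) + 1) ^ 4 * Real.exp (9 * (uc + R)) +
        3 * Real.pi * ((n:ℝ) + 1) ^ 2 * Real.exp (5 * (uc + R)) := by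
    have e9 : Real.exp (9 * z.re) ≤ Real.exp (9 * (uc + R)) := Real.exp_le_exp.2 (by linarith)
    have e5 : Real.exp (5 * z.re) ≤ Real.exp (5 * (uc + R)) := Real.exp_le_exp.2 (by linarith)
    have c1 : (0:ℝ) ≤ 2 * Real.pi ^ 2 * ((n:ℝ) + 1) ^ 4 := by positivity
    have c2 : (0:ℝ) ≤ 3 * Real.pi * ((n:ℝ) + 1) ^ 2 := by positivity
    nlinarith [mul_le_mul_of_nonneg_left e9 c1, mul_le_mul_of_nonneg_left e5 c2]
  have hE : Real.exp (-(Real.pi * ((n:ℝ) + 1) ^ 2 * Real.exp (4 * z.re) * Real.cos (4 * z.im))) ≤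
      Real.exp (-(Real.pi * ((n:ℝ) + 1) ^ 2 * Real.exp (4 * (uc - R)) * (1 - 8 * R ^ 2))) := by
    apply Real.exp_le_exp.2
    have h1 : Real.exp (4 * (uc - R)) ≤ Real.exp (4 * z.re) := Real.exp_le_exp.2 (by linarith)
    have h2 : Real.exp (4 * (uc - R)) * (1 - 8 * R ^ 2) ≤ Real.exp (4 * z.re) * Real.cos (4 * z.im) :=
      mul_le_mul h1 hc4 hc4pos (Real.exp_pos _).le
    have : Real.pi * ((n:ℝ) + 1) ^ 2 * (Real.exp (4 * (uc - R)) * (1 - 8 * R ^ 2)) ≤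
        Real.pi * ((n:ℝ) + 1) ^ 2 * (Real.exp (4 * z.re) * Real.cos (4 * z.im)) :=
      mul_le_mul_of_nonneg_left h2 (by positivity)
    linarith
  exact mul_le_mul hA hE (Real.exp_pos _).le (by positivity)

/-- `‖cos(x' z)‖ ≤ e^{x' R}` for real `x' ≥ 0` and `|Im z| ≤ R`. [folklore] -/
theorem UniversalFactor.norm_cos_ofReal_mul_le {x' R : ℝ} (hx : 0 ≤ x') {z : ℂ} (hz : |z.im| ≤ R) :
    ‖Complex.cos ((x' : ℂ) * z)‖ ≤ Real.exp (x' * R) := by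
  refine (norm_cos_le_exp_abs_im _).trans (Real.exp_le_exp.2 ?_)
  have : ((x' : ℂ) * z).im = x' * z.im := by simp [Complex.mul_im]
  rw [this, abs_mul, abs_of_nonneg hx]
  exact mul_le_mul_of_nonneg_left hz hx

/-! ## One u-cell: the Gauss–Legendre part -/

/-- `S_N(u) = Φ_N(u)` at real `u`. [folklore] -/
theorem UniversalFactor.osaPhiNC_ofReal (N : ℕ) (u : ℝ) :
    UniversalFactor.osaPhiNC N (u : ℂ) = ((UniversalFactor.osaPhiN N u : ℝ) : ℂ) := by
  obtain ⟨-, hreal, -⟩ := UniversalFactor.stub_phiPartialC N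
  exact hreal u

/-- **GL error on one u-cell** (`uc = (2c+1)ρ`, `0 ≤ ρ < R ≤ 1/4`, `x' ≥ 0`):
`|∫_{−ρ}^{ρ} Φ_N(uc+s) cos(x'(uc+s)) ds − Σ_j ρW_j Φ_N(u_{cj}) cos(x' u_{cj})| ≤ PhiMaj · e^{x'R} · D(ρ,R)`.
[folklore] -/
theorem UniversalFactor.osaCell_gl_error {N : ℕ} {ρ R x' : ℝ} (hρ : 0 ≤ ρ) (hρR : ρ < R) (hR : R ≤ 1 / 4)
    (hx : 0 ≤ x') (c : ℕ) :
    |(∫ s in (-ρ)..ρ, UniversalFactor.osaPhiN N ((2 * c + 1) * ρ + s) * Real.cos (x' * ((2 * c + 1) * ρ + s))) -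
        UniversalFactor.osaCellGL N ρ x' c| ≤
      UniversalFactor.osaPhiMajR N ((2 * c + 1) * ρ) R * Real.exp (x' * R) * UniversalFactor.osaDefectR ρ R := by
  set uc : ℝ := (2 * c + 1) * ρ with huc
  have hR0 : 0 < R := lt_of_le_of_lt hρ hρR
  obtain ⟨hdiff, hreal, -⟩ := UniversalFactor.stub_phiPartialC N
  set f : ℂ → ℂ := fun w => UniversalFactor.osaPhiNC N w * Complex.cos ((x' : ℂ) * w) with hf
  have hfd : DifferentiableOn ℂ f (Metric.ball ((uc : ℝ) : ℂ) (R + 1)) := by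
    refine Differentiable.differentiableOn ?_
    have h1 : Differentiable ℂ (UniversalFactor.osaPhiNC N) := by
      have : UniversalFactor.osaPhiNC N = fun w : ℂ => ∑ n ∈ Finset.range N,
          (2 * (Real.pi : ℂ) ^ 2 * ((n : ℂ) + 1) ^ 4 * Complex.exp (9 * w) -
            3 * (Real.pi : ℂ) * ((n : ℂ) + 1) ^ 2 * Complex.exp (5 * w)) *
          Complex.exp (-((Real.pi : ℂ) * ((n : ℂ) + 1) ^ 2 * Complex.exp (4 * w))) := by
        funext w; rfl
      rw [this]; exact hdiff
    exact h1.mul (by fun_prop)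
  have hM : ∀ z ∈ Metric.sphere ((uc : ℝ) : ℂ) R,
      ‖f z‖ ≤ UniversalFactor.osaPhiMajR N uc R * Real.exp (x' * R) := by
    intro z hz
    have him : |z.im| ≤ R := by
      have h' := hz
      rw [Metric.mem_sphere, dist_eq_norm] at h'
      have := Complex.abs_im_le_norm (z - uc); simp at this; rw [← h']; exact this
    rw [hf]; dsimp only
    rw [norm_mul]
    exact mul_le_mul (UniversalFactor.norm_osaPhiNC_le hR0 hR hz)
      (UniversalFactor.norm_cos_ofReal_mul_le hx him) (norm_nonneg _)
      ((norm_nonneg _).trans (UniversalFactor.norm_osaPhiNC_le hR0 hR hz))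
  have hu : ∀ j ∈ Finset.range 32, |ρ * UniversalFactor.osaNodeR j| ≤ ρ := by
    intro j hj
    rw [abs_mul, abs_of_nonneg hρ]
    have := UniversalFactor.abs_osaNodeR_le (Finset.mem_range.1 hj)
    nlinarith [abs_nonneg (UniversalFactor.osaNodeR j)]
  have hq := UniversalFactor.stub_quadH f ((uc : ℝ) : ℂ) R (R + 1) ρ
    (UniversalFactor.osaPhiMajR N uc R * Real.exp (x' * R)) hρ hρR (by linarith) hfd hM
    (Finset.range 32) (fun j => ρ * UniversalFactor.osaNodeR j) (fun j => ρ * UniversalFactor.osaWeightR j) hu 63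
  -- identify the complex integral and node sum with the real ones
  have hfreal : ∀ s : ℝ, f ((uc : ℂ) + (s : ℂ)) =
      ((UniversalFactor.osaPhiN N (uc + s) * Real.cos (x' * (uc + s)) : ℝ) : ℂ) := by
    intro s
    rw [hf]; dsimp only
    rw [show ((uc : ℂ) + (s : ℂ)) = ((uc + s : ℝ) : ℂ) by push_cast; rfl,
      UniversalFactor.osaPhiNC_ofReal, show ((x' : ℂ) * ((uc + s : ℝ) : ℂ)) = ((x' * (uc + s) : ℝ) : ℂ) by push_cast; rfl,
      ← Complex.ofReal_cos]
    push_cast; rfl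
  have hint : (∫ s in (-ρ)..ρ, f ((uc : ℂ) + (s : ℂ))) =
      ((∫ s in (-ρ)..ρ, UniversalFactor.osaPhiN N (uc + s) * Real.cos (x' * (uc + s)) : ℝ) : ℂ) := by
    rw [← intervalIntegral.integral_ofReal]
    exact intervalIntegral.integral_congr fun s _ => hfreal s
  have hsum : ∑ j ∈ Finset.range 32, ((ρ * UniversalFactor.osaWeightR j : ℝ) : ℂ) *
      f ((uc : ℂ) + ((ρ * UniversalFactor.osaNodeR j : ℝ) : ℂ)) =
      ((UniversalFactor.osaCellGL N ρ x' c : ℝ) : ℂ) := by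
    unfold UniversalFactor.osaCellGL
    push_cast
    refine Finset.sum_congr rfl fun j _ => ?_
    rw [show ((ρ : ℂ) * (UniversalFactor.osaNodeR j : ℂ)) = ((ρ * UniversalFactor.osaNodeR j : ℝ) : ℂ) by push_cast; rfl,
      hfreal]
    simp only [huc]
    push_cast; ring
  rw [hint, hsum, ← Complex.ofReal_sub, Complex.norm_real, Real.norm_eq_abs] at hq
  refine hq.trans (le_of_eq ?_)
  unfold UniversalFactor.osaDefectR
  simp only [show (63 : ℕ) + 1 = 64 from rfl]

/-! ## One u-cell: the theta tail part -/

/-- **Theta-tail error on one u-cell** (`uc − ρ ≥ 0`, `N ≥ 1`):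
`|∫_{−ρ}^{ρ} (Φ − Φ_N)(uc+s) cos(x'(uc+s)) ds| ≤ 2ρ T_N(uc − ρ)`. [folklore] -/
theorem UniversalFactor.osaCell_tail_error {N : ℕ} (hN : 1 ≤ N) {ρ uc x' : ℝ} (hρ : 0 ≤ ρ) (huc : 0 ≤ uc - ρ) :
    |∫ s in (-ρ)..ρ, (deBruijnPhi (uc + s) - UniversalFactor.osaPhiN N (uc + s)) * Real.cos (x' * (uc + s))| ≤
      2 * ρ * UniversalFactor.osaThetaT N (uc - ρ) := by
  have h := intervalIntegral.norm_integral_le_of_norm_le_const (a := -ρ) (b := ρ)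
    (C := UniversalFactor.osaThetaT N (uc - ρ))
    (f := fun s => (deBruijnPhi (uc + s) - UniversalFactor.osaPhiN N (uc + s)) * Real.cos (x' * (uc + s))) ?_
  · rw [Real.norm_eq_abs] at h
    refine h.trans (le_of_eq ?_)
    rw [show ρ - -ρ = 2 * ρ by ring, abs_of_nonneg (by linarith)]; ring
  intro s hs
  have hs' : -ρ ≤ s ∧ s ≤ ρ := by
    rw [Set.uIoc_of_le (by linarith)] at hs; exact ⟨hs.1.le, hs.2⟩
  have hu0 : 0 ≤ uc + s := by linarith
  obtain ⟨hlo, hhi⟩ := UniversalFactor.stub_phiTailN N (uc + s) hN hu0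
  rw [Real.norm_eq_abs, abs_mul]
  have hcos : |Real.cos (x' * (uc + s))| ≤ 1 := Real.abs_cos_le_one _
  have hT : |deBruijnPhi (uc + s) - UniversalFactor.osaPhiN N (uc + s)| ≤ UniversalFactor.osaThetaT N (uc - ρ) := by
    unfold UniversalFactor.osaPhiN
    rw [abs_of_nonneg hlo]
    refine hhi.trans ?_
    have := UniversalFactor.osaThetaT_antitone hN huc (show uc - ρ ≤ uc + s by linarith)
    unfold UniversalFactor.osaThetaT at this ⊢
    exact this
  calc |deBruijnPhi (uc + s) - UniversalFactor.osaPhiN N (uc + s)| * |Real.cos (x' * (uc + s))|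
      ≤ UniversalFactor.osaThetaT N (uc - ρ) * 1 :=
        mul_le_mul hT hcos (abs_nonneg _) ((abs_nonneg _).trans hT)
    _ = _ := mul_one _

/-! ## One u-cell: total -/

/-- The real integrand `Φ(u) cos(x'u)` is continuous on `[0, ∞)`. [folklore] -/
theorem UniversalFactor.continuousOn_phi_mul_cos (x' : ℝ) :
    ContinuousOn (fun u : ℝ => deBruijnPhi u * Real.cos (x' * u)) (Ici 0) :=
  continuousOn_deBruijnPhi_Ici.mul (by fun_prop : Continuous fun u : ℝ => Real.cos (x' * u)).continuousOn

/-- The real integrand `Φ(u) cos(x'u)` is integrable on `(0, ∞)`. [folklore] -/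
theorem UniversalFactor.integrableOn_phi_mul_cos (x' : ℝ) :
    IntegrableOn (fun u : ℝ => deBruijnPhi u * Real.cos (x' * u)) (Ioi 0) := by
  have h : IntegrableOn (fun u : ℝ => RCLike.re (((deBruijnPhi u : ℝ) : ℂ) * Complex.cos ((x' : ℂ) * u))) (Ioi 0) :=
    (integrableOn_deBruijnPhi_mul_cos (x' : ℂ)).re
  refine IntegrableOn.congr_fun h (fun u _ => ?_) measurableSet_Ioi
  simp only [← Complex.ofReal_mul, ← Complex.ofReal_cos, Complex.ofReal_re, RCLike.re_to_complex]

/-- `H_0(x')` is the real cosine transform of `Φ` at real `x'`. [folklore] -/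
theorem UniversalFactor.deBruijnH_zero_ofReal_re (x' : ℝ) :
    (deBruijnH 0 (x' : ℂ)).re = ∫ u in Ioi (0:ℝ), deBruijnPhi u * Real.cos (x' * u) := by
  rw [deBruijnH_zero_eq_integral_cos]
  have : (fun u : ℝ => ((deBruijnPhi u : ℝ) : ℂ) * Complex.cos ((x' : ℂ) * u)) =
      fun u : ℝ => ((deBruijnPhi u * Real.cos (x' * u) : ℝ) : ℂ) := by
    funext u; push_cast; ring
  rw [this, integral_complex_ofReal, Complex.ofReal_re]

/-- **Total error on one u-cell**:
`|∫_{2cρ}^{2(c+1)ρ} Φ(u)cos(x'u) du − GL_c| ≤ PhiMaj_c e^{x'R} D + 2ρ T_N(2cρ)`. [folklore] -/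
theorem UniversalFactor.osaCell_error {N : ℕ} (hN : 1 ≤ N) {ρ R x' : ℝ} (hρ : 0 ≤ ρ) (hρR : ρ < R)
    (hR : R ≤ 1 / 4) (hx : 0 ≤ x') (c : ℕ) :
    |(∫ u in (2 * c * ρ)..(2 * (c + 1) * ρ), deBruijnPhi u * Real.cos (x' * u)) -
        UniversalFactor.osaCellGL N ρ x' c| ≤
      UniversalFactor.osaPhiMajR N ((2 * c + 1) * ρ) R * Real.exp (x' * R) * UniversalFactor.osaDefectR ρ R +
        2 * ρ * UniversalFactor.osaThetaT N (2 * c * ρ) := by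
  set uc : ℝ := (2 * c + 1) * ρ with huc
  have hc0 : (0:ℝ) ≤ c := Nat.cast_nonneg c
  have hucρ : 0 ≤ uc - ρ := by rw [huc]; nlinarith
  -- shift to the symmetric cell
  have hshift : (∫ u in (2 * c * ρ)..(2 * (c + 1) * ρ), deBruijnPhi u * Real.cos (x' * u)) =
      ∫ s in (-ρ)..ρ, deBruijnPhi (uc + s) * Real.cos (x' * (uc + s)) := by
    have h := intervalIntegral.integral_comp_add_left (a := -ρ) (b := ρ)
      (fun u => deBruijnPhi u * Real.cos (x' * u)) uc
    rw [h]; congr 1 <;> rw [huc] <;> ring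
  rw [hshift]
  -- split Φ = Φ_N + (Φ − Φ_N)
  have hcontA : Continuous fun s : ℝ => UniversalFactor.osaPhiN N (uc + s) * Real.cos (x' * (uc + s)) := by
    unfold UniversalFactor.osaPhiN
    refine Continuous.mul (continuous_finsetSum _ fun n _ => ?_) (by fun_prop)
    exact (continuous_deBruijnPhiSummand n).comp (by fun_prop)
  have hcontG : ContinuousOn (fun s : ℝ => deBruijnPhi (uc + s) * Real.cos (x' * (uc + s))) (uIcc (-ρ) ρ) := by
    have h1 : ContinuousOn (fun s : ℝ => deBruijnPhi (uc + s)) (uIcc (-ρ) ρ) := by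
      refine continuousOn_deBruijnPhi_Ici.comp (by fun_prop : Continuous fun s : ℝ => uc + s).continuousOn ?_
      intro s hs
      rw [uIcc_of_le (by linarith)] at hs
      simp only [mem_Ici]; linarith [hs.1]
    exact h1.mul (by fun_prop : Continuous fun s : ℝ => Real.cos (x' * (uc + s))).continuousOn
  have hiA : IntervalIntegrable (fun s : ℝ => UniversalFactor.osaPhiN N (uc + s) * Real.cos (x' * (uc + s)))
      volume (-ρ) ρ := hcontA.intervalIntegrable _ _
  have hiG : IntervalIntegrable (fun s : ℝ => deBruijnPhi (uc + s) * Real.cos (x' * (uc + s))) volume (-ρ) ρ :=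
    hcontG.intervalIntegrable
  have hiB : IntervalIntegrable
      (fun s : ℝ => (deBruijnPhi (uc + s) - UniversalFactor.osaPhiN N (uc + s)) * Real.cos (x' * (uc + s)))
      volume (-ρ) ρ :=
    (hiG.sub hiA).congr fun s _ => by show _ - _ = _; ring
  have hsplit : (∫ s in (-ρ)..ρ, deBruijnPhi (uc + s) * Real.cos (x' * (uc + s))) =
      (∫ s in (-ρ)..ρ, UniversalFactor.osaPhiN N (uc + s) * Real.cos (x' * (uc + s))) +
        ∫ s in (-ρ)..ρ, (deBruijnPhi (uc + s) - UniversalFactor.osaPhiN N (uc + s)) * Real.cos (x' * (uc + s)) := by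
    rw [← intervalIntegral.integral_add hiA hiB]
    exact intervalIntegral.integral_congr fun s _ => by ring
  rw [hsplit]
  have h1 := UniversalFactor.osaCell_gl_error (N := N) hρ hρR hR hx c
  have h2 := UniversalFactor.osaCell_tail_error hN (x' := x') hρ hucρ
  rw [← huc] at h1
  have e : uc - ρ = 2 * c * ρ := by rw [huc]; ring
  rw [e] at h2
  calc |(∫ s in (-ρ)..ρ, UniversalFactor.osaPhiN N (uc + s) * Real.cos (x' * (uc + s))) +
        (∫ s in (-ρ)..ρ, (deBruijnPhi (uc + s) - UniversalFactor.osaPhiN N (uc + s)) * Real.cos (x' * (uc + s))) -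
        UniversalFactor.osaCellGL N ρ x' c|
      = |((∫ s in (-ρ)..ρ, UniversalFactor.osaPhiN N (uc + s) * Real.cos (x' * (uc + s))) -
          UniversalFactor.osaCellGL N ρ x' c) +
          ∫ s in (-ρ)..ρ, (deBruijnPhi (uc + s) - UniversalFactor.osaPhiN N (uc + s)) * Real.cos (x' * (uc + s))| := by
        congr 1; ring
    _ ≤ _ := (abs_add_le _ _).trans (add_le_add h1 h2)

/-! ## The global decomposition of `H_0(x')` -/

/-- `∫₀^∞ Φ cos = Σ_{c<Cu} ∫_{cell c} Φ cos + ∫_{U}^∞ Φ cos`, `U = 2 Cu ρ`. [folklore] -/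
theorem UniversalFactor.osaH0_decomp (x' : ℝ) {ρ : ℝ} (hρ : 0 ≤ ρ) (Cu : ℕ) :
    (∫ u in Ioi (0:ℝ), deBruijnPhi u * Real.cos (x' * u)) =
      ∑ c ∈ Finset.range Cu, (∫ u in (2 * c * ρ)..(2 * (c + 1) * ρ), deBruijnPhi u * Real.cos (x' * u)) +
        ∫ u in Ioi (2 * Cu * ρ), deBruijnPhi u * Real.cos (x' * u) := by
  have hint := UniversalFactor.integrableOn_phi_mul_cos x'
  have hU : (0:ℝ) ≤ 2 * Cu * ρ := by positivity
  have hsum := intervalIntegral.sum_integral_adjacent_intervals (f := fun u => deBruijnPhi u * Real.cos (x' * u))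
    (μ := volume) (a := fun k : ℕ => 2 * (k : ℝ) * ρ) (n := Cu) ?_
  · simp only [Nat.cast_zero, mul_zero, zero_mul] at hsum
    have hsum' : ∑ c ∈ Finset.range Cu, (∫ u in (2 * c * ρ)..(2 * (c + 1) * ρ), deBruijnPhi u * Real.cos (x' * u)) =
        ∫ u in (0:ℝ)..(2 * Cu * ρ), deBruijnPhi u * Real.cos (x' * u) := by
      rw [← hsum]
      refine Finset.sum_congr rfl fun c _ => ?_
      push_cast; rfl
    rw [hsum', intervalIntegral.integral_interval_add_Ioi hint (hint.mono_set (Ioi_subset_Ioi hU))]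
  · intro k _
    refine ((UniversalFactor.continuousOn_phi_mul_cos x').mono ?_).intervalIntegrable
    have hk : (0:ℝ) ≤ 2 * k * ρ := by positivity
    have hk1 : 2 * (k : ℝ) * ρ ≤ 2 * ((k + 1 : ℕ) : ℝ) * ρ := by push_cast; nlinarith
    rw [uIcc_of_le hk1]
    exact fun u hu => le_trans hk hu.1

/-- **u-tail**: `|∫_U^∞ Φ(u) cos(x'u) du| ≤ 50 e^{9U − πe^{4U}} / (4πe^{4U} − 9)` for `U ≥ 0`. [folklore] -/
theorem UniversalFactor.osaUTail_error (x' : ℝ) {U : ℝ} (hU : 0 ≤ U) :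
    |∫ u in Ioi U, deBruijnPhi u * Real.cos (x' * u)| ≤
      50 * Real.exp (9 * U - Real.pi * Real.exp (4 * U)) / (4 * Real.pi * Real.exp (4 * U) - 9) := by
  refine le_trans ?_ (UniversalFactor.stub_phiIoiTail U hU)
  have hint : IntegrableOn deBruijnPhi (Ioi U) := integrableOn_deBruijnPhi_Ioi.mono_set (Ioi_subset_Ioi hU)
  have h := norm_integral_le_of_norm_le hint
    (f := fun u : ℝ => deBruijnPhi u * Real.cos (x' * u)) (μ := volume.restrict (Ioi U)) ?_
  · simpa only [Real.norm_eq_abs] using h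
  · rw [ae_restrict_iff' measurableSet_Ioi]
    refine Filter.Eventually.of_forall fun u hu => ?_
    have hu0 : 0 ≤ u := hU.trans (le_of_lt hu)
    rw [Real.norm_eq_abs, abs_mul, abs_of_pos (deBruijnPhi_pos_of_nonneg hu0)]
    calc deBruijnPhi u * |Real.cos (x' * u)| ≤ deBruijnPhi u * 1 :=
          mul_le_mul_of_nonneg_left (Real.abs_cos_le_one _) (deBruijnPhi_pos_of_nonneg hu0).le
      _ = deBruijnPhi u := mul_one _

/-- **Registered sub-goal `stub_osaCellError`** (the total error of one u-cell). [folklore] -/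
theorem UniversalFactor.stub_osaCellError :
    ∀ (N : ℕ), 1 ≤ N → ∀ (ρ R x' : ℝ), 0 ≤ ρ → ρ < R → R ≤ 1 / 4 → 0 ≤ x' → ∀ (c : ℕ),
      |(∫ u in (2 * c * ρ)..(2 * (c + 1) * ρ), deBruijnPhi u * Real.cos (x' * u)) - UniversalFactor.osaCellGL N ρ x' c| ≤
        UniversalFactor.osaPhiMajR N ((2 * c + 1) * ρ) R * Real.exp (x' * R) * UniversalFactor.osaDefectR ρ R +
          2 * ρ * UniversalFactor.osaThetaT N (2 * c * ρ) :=
  fun _ hN _ _ _ hρ hρR hR hx c => UniversalFactor.osaCell_error hN hρ hρR hR hx c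

end Summit.RiemannHypothesis.RiemannHypothesis.Theorems
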